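import Summits.QuantumFields.BalabanUV.Beta.GAN24.TorusAvatar

/-!
# `BalabanUV.Beta.GAN24.TorusAvatarBridge` — binder row G-an2-4 / (CONV-C), S6 dictionary (mm channel), leaf P1-L13a part 2 (S6mm-1b):
# THE OPERATOR BRIDGE — on torus avatars of periodic lattice forms, b05's block average `QvOp` ((1.18)) IS an2's `contourSum` (÷ `N^{D+1}`),
# its matrix adjoint IS an2's `contourSumAdj` (× `N^{−(D+1)}`), and b05's `(CurlOp)ᴴ·CurlOp` ((1.2), (1.21)) IS an2's Euler–Lagrange operator
# `curvAdj ∘ curv` (× `c²`)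

NOT IN PRINT; OUR BOOKKEEPING.  HONEST FRAMING (cell contract, verbatim): «discharging `BetaPertH` makes Bałaban's UV stability
UNCONDITIONAL — a real constructive-QFT result; it is NOT the continuum limit and NOT the Clay problem.»  HONEST DEPENDENCY (verbatim):
«continuum YM on T⁴ ⇐ BetaPertH ∧ nine spine estimates (0/9 proved); BetaPertH ⇐ (D1) ∧ (D4) ∧ CAP+tail; G-an2-4 gates asym, D1 and
NE2/3/4.»  [folklore] finite-sum bookkeeping over the two lineages' OWN definitions (`B5Block118.QvOp`, `B5Action121.CurlOp`/`sdiff`,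
`AffineAveraging.contourSum`/`curv`/`curvAdj`, `AffineReproduction.contourSumAdj`); cites nothing, mints no fact, instantiates no binder.
NOT summit progress.

THE THREE BRIDGES (0 sorry; `A` an `(N·M)`-periodic fine 1-form, `φ` an `M`-periodic coarse 1-form, `av` the avatar of `GAN24/TorusAvatar`):
* **`QvOp_av`**: `(QvOp N M *ᵥ av A) (y, μ) = (N^{D+1})⁻¹ · contourSum N A μ (lift y)` — (1.18)'s `η^{d+1} Σ_{x∈B(y)} A([x, x(b)])` is an2's
  unnormalised straight-contour block sum (`sum_box_eq`: b05's offsets `Fin D → Fin N` ↔ an2's `box D N`; `toTor_bpt`).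
* **`av_contourSumAdj`**: `av (contourSumAdj N φ) (z, κ) = N^{D+1} · ((QvOp N M)ᴴ *ᵥ av φ) (z, κ)` — via the closed form
  **`QvOp_conjTranspose_mulVec`**: `((QvOp)ᴴ g)(z, κ) = N^{−(D+1)} Σ_{t<N} g(blk(z − t e_κ), κ)` (the fine bond `(z,κ)` lies on exactly the `N`
  straight `κ`-contours starting in the blocks of `z − t e_κ`; uniqueness = `blockEquiv`), and `contourSumAdj_liftT`.
* **`curlAdj_curl_av`**: `((CurlOp P c)ᴴ * CurlOp P c) *ᵥ av A = c² • av (curvAdj (curv A))` — from **`CurlOp_av`** (`∂(av A) = c • av₂(curv A)`: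
  (1.2) and an2's `curv` are the same four terms), the closed form **`CurlOp_conjTranspose_mulVec`** of b05's matrix adjoint, and
  **`CurlOp_conjTranspose_av₂`** (`(∂)ᴴ(av₂ F) = c • av(curvAdj F)`: an2's FORMAL adjoint is b05's MATRIX adjoint on avatars).
With `B5Action121.curl_adjoint_curl` (`(CurlOp)ᴴCurlOp = 2(Δ − ∂∂*)`) and `B5Hk163RDiv.DstarD`, the third bridge reads `DstarD (av A) = (c²/2)·av(curvAdj(curv A))`
at `c = n`: an2's energy `‖curv A‖²` has Euler–Lagrange operator `curvAdj ∘ curv = 2·(plain ∂*∂)` (the «factor 2» of GAPS C-gan24p2-5 (b)(ii)).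
NEXT (P1-L13b `GAN24/TorusJunction`): the Gram identity of an2's periodised minimiser column against b05's `HkOp` column.
Unit b2b-balaban-gan24-formalise-leaf-18 (gen 5), 2026-08-19.  NOT the K-slot, NOT `BetaPertH`, NOT continuum, NOT Clay.
-/

open Finset
open scoped BigOperators ComplexConjugate Matrix

namespace Summit.QuantumFields.BalabanUV.Beta.GAN24.TorusAvatar

open Literature.MathematicalPhysics.QuantumFieldTheory
open Literature.MathematicalPhysics.QuantumFieldTheory.Balaban1983to89
open Literature.MathematicalPhysics.QuantumFieldTheory.Balaban1983to89.Beta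
open AffineAveraging (Site Form0 Form1 Form2 dz curv curvAdj box toSite contourSum)
open AffineReproduction (contourSumAdj)
open B5Prop11Plancherel (Tor fine)
open B5Block118 (QvOp QvOp_mulVec lineSum bpt up upHom upHom_intCast iota tstep)
open B5Action121 (CurlOp CurlOp_mulVec Fs_apply sdiff sdiff_conjTranspose_mulVec)

noncomputable section

variable {D : ℕ}

/-! ## §5 THE AVERAGING BRIDGE: b05's `Q_k` ((1.18), `QvOp`) on avatars = an2's unnormalised `contourSum`, divided by `N^{D+1}` -/

section Averaging

variable (N : ℕ) [NeZero N] (M : Fin D → ℕ) [∀ ν, NeZero (M ν)]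

omit [NeZero N] in
/-- Summing over b05's offsets `Fin D → Fin N` is summing over an2's `box D N`. -/
theorem sum_box_eq {β : Type*} [AddCommMonoid β] (g : (Fin D → ℕ) → β) :
    ∑ b ∈ box D N, g b = ∑ j : Fin D → Fin N, g (fun i => (j i : ℕ)) := by
  refine (Finset.sum_bij' (fun (j : Fin D → Fin N) _ => fun i => (j i : ℕ))
    (fun b hb => fun i => ⟨b i, Finset.mem_range.1 ((Fintype.mem_piFinset.1 hb) i)⟩) ?_ ?_ ?_ ?_ ?_).symm
  · intro j _
    exact Fintype.mem_piFinset.2 fun i => Finset.mem_range.2 (j i).isLt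
  · intro b hb; exact Finset.mem_univ _
  · intro j _; rfl
  · intro b hb; rfl
  · intro j _; rfl

/-- **THE AVERAGING BRIDGE** (fine side): for an `(N·M)`-periodic fine 1-form `A`,
`(Q_k (av A))(ȳ, μ) = N^{−(D+1)} · (contourSum N A)_μ(lift ȳ)` — b05's (1.18) block average of the avatar IS an2's straight-contour
block sum at the lifted block index, up to the printed normalisation `η^{d+1} = N^{−(D+1)}`. -/
theorem QvOp_av {A : Form1 D ℝ} (hA : ∀ κ, Periodic (fine N M) (A κ)) (y : Tor M) (μ : Fin D) :
    (QvOp N M *ᵥ av A) (y, μ) = ((N : ℂ) ^ (D + 1))⁻¹ * ((contourSum N A μ (liftT y) : ℝ) : ℂ) := by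
  rw [QvOp_mulVec, one_div]
  congr 1
  simp only [lineSum, contourSum, Complex.ofReal_sum]
  rw [sum_box_eq]
  refine Finset.sum_congr rfl fun j _ => ?_
  rw [Finset.sum_range]
  refine Finset.sum_congr rfl fun t _ => ?_
  rw [av_apply, (hA μ).apply_liftT (y := (N : ℤ) • liftT y + toSite (fun i => (j i : ℕ)) + ((t : ℕ) : ℤ) • AffineAveraging.unitVec μ)]
  rw [toTor_add, toTor_bpt, toTor_tstep]

omit [NeZero N] [∀ ν, NeZero (M ν)] in
/-- The block index (an2's `quo N`) of a lifted fine torus point reduces to b05's block index `blk`. -/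
theorem toTor_quo_liftT (z : Tor (fine N M)) : toTor M (LatticeForm.quo N (liftT z)) = blk N M z := by
  funext ν
  simp only [toTor, LatticeForm.quo, blk]
  rw [show liftT z ν = ((z ν).val : ℤ) from rfl, ← Int.natCast_div, Int.cast_natCast]

omit [∀ ν, NeZero (M ν)] in
/-- Congruent fine points (mod `N·M`) have congruent block indices (mod `M`). -/
theorem toTor_quo_congr {x y : Site D} (h : toTor (fine N M) x = toTor (fine N M) y) :
    toTor M (LatticeForm.quo N x) = toTor M (LatticeForm.quo N y) := by
  funext ν
  have hν := congr_fun h ν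
  simp only [toTor] at hν ⊢
  obtain ⟨k, hk⟩ := (ZMod.intCast_eq_intCast_iff_dvd_sub _ _ _).1 hν
  rw [ZMod.intCast_eq_intCast_iff_dvd_sub]
  refine ⟨k, ?_⟩
  simp only [LatticeForm.quo]
  have hN : (N : ℤ) ≠ 0 := by exact_mod_cast NeZero.ne N
  have e : y ν = x ν + (N : ℤ) * (((M ν : ℕ) : ℤ) * k) := by
    have : y ν - x ν = ((fine N M ν : ℕ) : ℤ) * k := hk
    simp only [fine, Nat.cast_mul] at this
    linarith
  rw [e, Int.add_mul_ediv_left _ _ hN]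
  ring

/-- The matrix adjoint of b05's `QvOp` in closed form: `((Q_k)ᴴ g)(z, κ) = N^{−(D+1)} Σ_{t<N} g(block of (z − t e_κ), κ)` — the fine bond
`(z, κ)` lies on exactly the `N` straight `κ`-contours starting in the blocks of `z − t e_κ`, `t < N`. -/
theorem QvOp_conjTranspose_mulVec (g : Tor M × Fin D → ℂ) (z : Tor (fine N M)) (κ : Fin D) :
    ((QvOp N M)ᴴ *ᵥ g) (z, κ) = ((N : ℂ) ^ (D + 1))⁻¹ * ∑ t : Fin N, g (blk N M (z - tstep (fine N M) κ t), κ) := by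
  have hcoef : ∀ (y : Tor M) (μ : Fin D), (QvOp N M)ᴴ (z, κ) (y, μ)
      = if κ = μ then ∑ j : Fin D → Fin N, ∑ t : Fin N,
          (if z = bpt N M y j + tstep (fine N M) μ t then ((N : ℂ) ^ (D + 1))⁻¹ else 0) else 0 := by
    intro y μ
    rw [Matrix.conjTranspose_apply, QvOp]
    dsimp only
    split_ifs with h
    · rw [star_sum]
      refine Finset.sum_congr rfl fun j _ => ?_
      rw [star_sum]
      refine Finset.sum_congr rfl fun t _ => ?_
      split_ifs
      · rw [one_div, star_inv₀, star_pow, Complex.star_def, Complex.conj_natCast]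
      · rw [star_zero]
    · rw [star_zero]
  have key : ∀ (t : Fin N) (p : Tor M × (Fin D → Fin N)),
      (z = bpt N M p.1 p.2 + tstep (fine N M) κ t) ↔ (p = (blockEquiv N M).symm (z - tstep (fine N M) κ t)) := by
    intro t p
    constructor
    · intro h
      have h' : (blockEquiv N M) p = z - tstep (fine N M) κ t := by
        rw [h]; simp [blockEquiv]
      rw [← h', Equiv.symm_apply_apply]
    · intro h
      have h' := congr_arg (blockEquiv N M) h
      rw [Equiv.apply_symm_apply] at h'
      simp only [blockEquiv, Equiv.coe_fn_mk] at h'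
      rw [h', sub_add_cancel]
  calc ((QvOp N M)ᴴ *ᵥ g) (z, κ) = ∑ y : Tor M, ∑ μ : Fin D, (QvOp N M)ᴴ (z, κ) (y, μ) * g (y, μ) := by
        simp only [Matrix.mulVec, dotProduct, Fintype.sum_prod_type]
    _ = ∑ y : Tor M, ∑ j : Fin D → Fin N, ∑ t : Fin N,
          (if z = bpt N M y j + tstep (fine N M) κ t then ((N : ℂ) ^ (D + 1))⁻¹ * g (y, κ) else 0) := by
        refine Finset.sum_congr rfl fun y _ => ?_
        simp only [hcoef, ite_mul, zero_mul, Finset.sum_ite_eq, Finset.mem_univ, if_true, Finset.sum_mul]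
    _ = ∑ y : Tor M, ∑ t : Fin N, ∑ j : Fin D → Fin N,
          (if z = bpt N M y j + tstep (fine N M) κ t then ((N : ℂ) ^ (D + 1))⁻¹ * g (y, κ) else 0) :=
        Finset.sum_congr rfl fun y _ => Finset.sum_comm
    _ = ∑ t : Fin N, ∑ y : Tor M, ∑ j : Fin D → Fin N,
          (if z = bpt N M y j + tstep (fine N M) κ t then ((N : ℂ) ^ (D + 1))⁻¹ * g (y, κ) else 0) := Finset.sum_comm
    _ = ∑ t : Fin N, ∑ p : Tor M × (Fin D → Fin N),
          (if z = bpt N M p.1 p.2 + tstep (fine N M) κ t then ((N : ℂ) ^ (D + 1))⁻¹ * g (p.1, κ) else 0) :=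
        Finset.sum_congr rfl fun t _ => (Fintype.sum_prod_type' fun (y : Tor M) (j : Fin D → Fin N) =>
          (if z = bpt N M y j + tstep (fine N M) κ t then ((N : ℂ) ^ (D + 1))⁻¹ * g (y, κ) else 0)).symm
    _ = ∑ t : Fin N, ((N : ℂ) ^ (D + 1))⁻¹ * g (blk N M (z - tstep (fine N M) κ t), κ) := by
        refine Finset.sum_congr rfl fun t _ => ?_
        simp_rw [key t]
        rw [Finset.sum_ite_eq' Finset.univ, if_pos (Finset.mem_univ _)]
        rfl
    _ = _ := by rw [Finset.mul_sum]

/-- an2's `contourSumAdj` at a lifted fine point, in b05's block coordinates (for an `M`-periodic coarse form). -/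
theorem contourSumAdj_liftT {φ : Form1 D ℝ} (hφ : ∀ κ, Periodic M (φ κ)) (z : Tor (fine N M)) (κ : Fin D) :
    contourSumAdj N φ κ (liftT z) = ∑ t : Fin N, φ κ (liftT (blk N M (z - tstep (fine N M) κ t))) := by
  rw [KKTFluctuationEnergy.contourSumAdj_eq, Finset.sum_range]
  refine Finset.sum_congr rfl fun t _ => ?_
  refine (hφ κ).congr ?_
  rw [toTor_liftT, ← toTor_quo_liftT N M (z - tstep (fine N M) κ t)]
  refine toTor_quo_congr N M ?_
  rw [toTor_sub, toTor_liftT, toTor_liftT, toTor_tstep]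

/-- **THE AVERAGING BRIDGE** (adjoint side): for an `M`-periodic coarse 1-form `φ`,
`av (𝒬ᵀ_N φ)(z, κ) = N^{D+1} · ((Q_k)ᴴ (av φ))(z, κ)` — an2's `contourSumAdj` (the formal adjoint of `contourSum` on `ℤ^D`) is, on avatars,
`N^{D+1}` times the matrix adjoint of b05's `QvOp`. -/
theorem av_contourSumAdj {φ : Form1 D ℝ} (hφ : ∀ κ, Periodic M (φ κ)) (z : Tor (fine N M)) (κ : Fin D) :
    av (contourSumAdj N φ) (z, κ) = (N : ℂ) ^ (D + 1) * ((QvOp N M)ᴴ *ᵥ av φ) (z, κ) := by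
  have hN : ((N : ℂ) ^ (D + 1)) ≠ 0 := pow_ne_zero _ (Nat.cast_ne_zero.2 (NeZero.ne N))
  rw [QvOp_conjTranspose_mulVec, ← mul_assoc, mul_inv_cancel₀ hN, one_mul, av_apply, contourSumAdj_liftT N M hφ,
    Complex.ofReal_sum]
  rfl

end Averaging

/-! ## §6 THE CURVATURE BRIDGE: b05's `CurlOp` ((1.2), factor `c = η⁻¹`) on avatars = an2's `curv` / `curvAdj` -/

section Curl

variable (P : Fin D → ℕ) [∀ ν, NeZero (P ν)] (c : ℕ)

/-- **`CurlOp` ON AN AVATAR IS THE AVATAR OF `curv`** (times the lattice factor `c`): for a `P`-periodic fine 1-form `A`,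
`(∂ (av A))(z, (μ,ν)) = c · (curv A)_{μν}(lift z)` — b05's plaquette field (1.2) and an2's `curv` are the same four-term expression. -/
theorem CurlOp_av {A : Form1 D ℝ} (hA : ∀ κ, Periodic P (A κ)) :
    CurlOp P (c : ℂ) *ᵥ av A = (c : ℂ) • av₂ (curv A) := by
  funext i
  rcases i with ⟨z, μ, ν⟩
  rw [CurlOp_mulVec, Fs_apply, Pi.smul_apply, av₂_apply, smul_eq_mul, av_add_unitVec hA, av_add_unitVec hA, av_apply, av_apply]
  simp only [curv]
  push_cast
  ring

/-- The matrix adjoint of b05's `CurlOp` in closed form: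
`((∂)ᴴ G)(y, μ) = c̄ · (Σ_a (G(y − e_a, (a,μ)) − G(y, (a,μ))) − Σ_b (G(y − e_b, (μ,b)) − G(y, (μ,b))))`. -/
theorem CurlOp_conjTranspose_mulVec (G : Tor P × (Fin D × Fin D) → ℂ) (y : Tor P) (μ : Fin D) :
    ((CurlOp P (c : ℂ))ᴴ *ᵥ G) (y, μ)
      = (c : ℂ) * ((∑ a, (G (y - B5Prop11Plancherel.unitVec P a, (a, μ)) - G (y, (a, μ))))
          - ∑ b, (G (y - B5Prop11Plancherel.unitVec P b, (μ, b)) - G (y, (μ, b)))) := by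
  -- the two halves of `CurlOp` are componentwise `sdiff`s; their adjoints are `sdiff_conjTranspose_mulVec`
  have h1 : ∀ a : Fin D, ∑ x : Tor P, star (sdiff P (c : ℂ) a x y) * G (x, (a, μ))
      = ((sdiff P (c : ℂ) a)ᴴ *ᵥ fun x => G (x, (a, μ))) y := fun a => rfl
  have h2 : ∀ b : Fin D, ∑ x : Tor P, star (sdiff P (c : ℂ) b x y) * G (x, (μ, b))
      = ((sdiff P (c : ℂ) b)ᴴ *ᵥ fun x => G (x, (μ, b))) y := fun b => rfl
  calc ((CurlOp P (c : ℂ))ᴴ *ᵥ G) (y, μ)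
      = ∑ x : Tor P, ∑ a : Fin D, ∑ b : Fin D, star (CurlOp P (c : ℂ) (x, (a, b)) (y, μ)) * G (x, (a, b)) := by
        simp only [Matrix.mulVec, dotProduct, Matrix.conjTranspose_apply, Fintype.sum_prod_type]
    _ = ∑ x : Tor P, ((∑ a : Fin D, star (sdiff P (c : ℂ) a x y) * G (x, (a, μ)))
          - ∑ b : Fin D, star (sdiff P (c : ℂ) b x y) * G (x, (μ, b))) := by
        refine Finset.sum_congr rfl fun x _ => ?_
        simp only [CurlOp, star_sub, sub_mul, Finset.sum_sub_distrib, apply_ite (star : ℂ → ℂ), star_zero, ite_mul, zero_mul]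
        congr 1
        · refine Finset.sum_congr rfl fun a _ => ?_
          rw [Finset.sum_ite_eq Finset.univ μ, if_pos (Finset.mem_univ _)]
        · rw [Finset.sum_comm]
          refine Finset.sum_congr rfl fun b _ => ?_
          rw [Finset.sum_ite_eq Finset.univ μ, if_pos (Finset.mem_univ _)]
    _ = (∑ a : Fin D, ∑ x : Tor P, star (sdiff P (c : ℂ) a x y) * G (x, (a, μ)))
          - ∑ b : Fin D, ∑ x : Tor P, star (sdiff P (c : ℂ) b x y) * G (x, (μ, b)) := by
        rw [Finset.sum_sub_distrib, Finset.sum_comm, Finset.sum_comm (f := fun x b => star (sdiff P (c : ℂ) b x y) * G (x, (μ, b)))]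
    _ = (∑ a : Fin D, ((sdiff P (c : ℂ) a)ᴴ *ᵥ fun x => G (x, (a, μ))) y)
          - ∑ b : Fin D, ((sdiff P (c : ℂ) b)ᴴ *ᵥ fun x => G (x, (μ, b))) y := by
        simp only [h1, h2]
    _ = _ := by
        simp only [sdiff_conjTranspose_mulVec, Complex.conj_natCast]
        rw [← Finset.mul_sum, ← Finset.mul_sum, mul_sub]

/-- **`CurlOpᴴ` ON A 2-FORM AVATAR IS THE AVATAR OF `curvAdj`** (times `c`): for a `P`-periodic 2-form `F`,
`((∂)ᴴ (av₂ F))(y, μ) = c · (curvAdj F)_μ(lift y)` — an2's formal adjoint `curvAdj` IS the matrix adjoint of b05's `CurlOp` on avatars. -/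
theorem CurlOp_conjTranspose_av₂ {F : Form2 D ℝ} (hF : ∀ κ l, Periodic P (F κ l)) :
    (CurlOp P (c : ℂ))ᴴ *ᵥ av₂ F = (c : ℂ) • av (curvAdj F) := by
  funext i
  rcases i with ⟨y, μ⟩
  rw [CurlOp_conjTranspose_mulVec, Pi.smul_apply, av_apply, smul_eq_mul]
  simp only [av₂_apply, av₂_sub_unitVec hF, curvAdj]
  push_cast
  simp only [Finset.sum_sub_distrib]
  ring

/-- **THE CURVATURE BRIDGE**: for a `P`-periodic fine 1-form `A`, `((∂)ᴴ∂)(av A) = c² · av (curvAdj (curv A))` — b05's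
`(CurlOp)ᴴ·CurlOp` (`= 2·(Δ − ∂∂*)`, `B5Action121.curl_adjoint_curl`; `= 2·DstarD` on `T_η`) is, on avatars, `c²` times an2's Euler–Lagrange
operator `curvAdj ∘ curv` of the energy `½‖curv A‖²`. -/
theorem curlAdj_curl_av {A : Form1 D ℝ} (hA : ∀ κ, Periodic P (A κ)) :
    ((CurlOp P (c : ℂ))ᴴ * CurlOp P (c : ℂ)) *ᵥ av A = ((c : ℂ) ^ 2) • av (curvAdj (curv A)) := by
  rw [← Matrix.mulVec_mulVec, CurlOp_av P c hA, Matrix.mulVec_smul,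
    CurlOp_conjTranspose_av₂ P c (fun κ l => Periodic.curv hA κ l), smul_smul, sq]

end Curl

end

end Summit.QuantumFields.BalabanUV.Beta.GAN24.TorusAvatar
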